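import Literature.NumberTheory.Rogawski1990.ArchBouazizClassMapWallTube     -- ★ p851565 (W0, this seat): chart types off `Z(b)`, fibre tubes, fibre points on the walls, (W0-main)
import Literature.NumberTheory.Automorphic.ArchCartanNormalisers             -- ★ `one_sub_coe_circleExp_sub_ne_zero_iff`
import Literature.NumberTheory.Automorphic.ArchCartanRegularDense            -- ★ `mem_closure_regS` (`RegS S` is dense)
import HarnessLib

/-!
# THE FRAME OF A WALL BASE CLASS: the central places `Z`, the split-regular part `S₀`, the `2^k` charts `S₀ ∪ T` with their fibre points ON the walls, tube regularity
# off `Z`, and the non-vanishing of the level normaliser — the package the payer of Bouaziz's wall surjectivity eats (Bouaziz 1994 §5.1–5.2; Shelstad 1979 §4; Rogawski 1990 §8.2)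

Topic `NumberTheory/Rogawski1990`; namespace `Literature.NumberTheory.Rogawski1990`.  THEOREMS ONLY (no `def`, no instance, no notation, no axiom, no named fact, no `sorry`);
group-free over a finite index type `W`.  Cell `pub/hodgecm-mathlib`, crux H413 (`stmt-HodgeConjecture-24833`), line LH3 (closer stub `stub_N9`), letter L3′, SURJ-OF-FORWARD road,
organ **(Σ-WALL)**, FILTRATION ROAD of LH3-p01 (g6) (W-ROAD CENSUS v1; (W4) ★-cand `bzLocalSurjWall_of_parts`, `F0/P3c/LH3/LH3-p01/g6/wall/ArchBouazizWallSurjectiveAssembly.rf.v2…`),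
brick **(W5-frame)** (binder's deal 2026-09-02T13:19:41Z, hand LH1-p03 (g7)): the FRAME PACKAGE instantiating (W4)'s free data `Z`, `S₀`, `Q` and discharging its hypotheses `hW0`, `hQ`
and the fibre-point∕regularity inputs of `hGen`∕`hW12`.  Author LH1-p03 (g7).  Count-neutral.

ROBUST INTERFACE.  `Z` and `S₀` enter as `Finset` VARIABLES with membership hypotheses `hZ : ∀ w, w ∈ Z ↔ (b w).1 ^ 2 = 4 * (b w).2.1` and `hS₀ : ∀ w, w ∈ S₀ ↔ w ∈ S_b ∧ (b w).1 ^ 2 ≠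
4 * (b w).2.1` (a reference chart `S_b` with a fibre point `c_b`, `bzClassMap S_b c_b = b`), so that the consumer may realise them by ANY `Finset.filter` expression (no decidability-instance
coupling); the literal `Finset.univ.filter …` ∕ `S_b.filter …` instances are the `…_filter` corollaries.
* §0 `exists_forall_sq_ne_four_mul_of_dist_lt` — near a NON-central class value the discriminant `t² − 4d` stays non-zero (continuity).
* §1 **(F0) DICHOTOMY** `exists_bzClassMap_eq_or_exists_forall_le_dist` — `b` is a class value of some chart, or a ball around `b` misses every class image (★ `isClosed_range_bzClassMap`) — the
  vacuous branch of the payer.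
* §2 **(F1) = `hW0` of (W4) VERBATIM** `exists_forall_sdiff_eq_of_dist_bzClassMap_lt (hb) (Z S₀) (hZ) (hS₀) : ∃ ε₀ > 0, ∀ S c, c ∈ RegS S → dist (bzClassMap S c) b < ε₀ → S \ Z = S₀`
  (★ (W0a) `exists_forall_mem_iff_of_dist_bzClassMap_lt`; the regularity hypothesis is not used).
* §3 **(F2) FIBRE POINTS OF THE LEVEL CHARTS** `exists_fibrePoint_wall (hb) (Z S₀) (hZ) (hS₀) (hT : T ⊆ Z)` — a point `c_T` with `bzClassMap (S₀ ∪ T) c_T = b`, ON the wall at the central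
  places (`c_T w 0 = c_T w 2` for `w ∈ Z ∖ T`, `c_T w 0 = 0` for `w ∈ T`), REGULAR at the places off `Z`, and in `closure (RegS (S₀ ∪ T))` (★ (W0c) `exists_bzClassMap_eq_of_forall_mem_iff`,
  ★ `mem_closure_regS`) — the `c₀` of (W12-asm) and of (W3-asm)'s (G3).
* §4 **(F3) TUBE REGULARITY OFF `Z`** `exists_forall_regular_off_of_dist_bzClassMap_lt (b) (Z) (hZ) : ∃ ε₁ > 0, ∀ S c, dist (bzClassMap S c) b < ε₁ → ∀ w, w ∉ Z → (w ∉ S → e^{i c_{w,0}} ≠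
  e^{i c_{w,2}}) ∧ (w ∈ S → c w 0 ≠ 0)` (every chart `S`, hence every `S₀ ∪ T`; the binder's text `…_union` is the corollary) — the `hreg₁` of (W12-asm).
* §5 **(F4) = `hQ` of (W4)** `prod_ite_one_sub_circleExp_ne_zero (S) (hc : c ∈ RegS S) : (∏ w, if w ∈ S then 1 else (1 − e^{i(c_{w,2} − c_{w,0})})) ≠ 0` (★ `one_sub_coe_circleExp_sub_ne_zero_iff`)
  and its `T ⊆ Z` reading `prod_ite_one_sub_circleExp_ne_zero_of_subset`.
HONEST LABEL: L3′ = «S-road organ-complete modulo (Σ-WALL) PRINT» until the W-bricks are ★; HC_CM is proved only modulo the 7 printed citations (2 remaining: hLiu418 =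
stmt-HodgeConjecture-24832, h413 = stmt-HodgeConjecture-24833) until rung 0 closes; coordinate bookkeeping, pays nothing by itself.

## References
* [Bouaziz1994IntegralesOrbitales] A. Bouaziz, *Intégrales orbitales sur les groupes de Lie réductifs*, Ann. Sci. ÉNS (4) 27 (1994) 573–609, §2.3 Lemme 2.3.1 p. 578, §4 proof of
  Thm 4.1.1 pp. 585–586 (the filtration), §5.1 p. 588, §5.2 p. 588.
* [Shelstad1979] D. Shelstad, *Characters and inner forms of a quasi-split group over ℝ*, Compositio Math. 39 (1979), §4 pp. 22–25 (`T_reg`, the Cayley point, `R_T`).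
* [Rogawski1990] J. D. Rogawski, *Automorphic Representations of Unitary Groups in Three Variables*, Ann. of Math. Stud. 123 (1990), §3.6 p. 31, §8.2 p. 122.
-/

set_option autoImplicit false

noncomputable section

open Complex Set Function Real Metric Filter Topology
open Literature.NumberTheory.Automorphic.ArchCartan

namespace Literature.NumberTheory.Rogawski1990

variable {W : Type*}

/-! ## §0 Near a non-central class value the discriminant stays non-zero -/

/-- **Near a NON-central class value `P₀` (`t² ≠ 4d`) every class datum is non-central** (the discriminant `P ↦ P.1² − 4·P.2.1` is continuous).
[cite: Bouaziz1994IntegralesOrbitales, §5.1 p. 588] [cite: Shelstad1979, §4 p. 22] -/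
theorem exists_forall_sq_ne_four_mul_of_dist_lt (P₀ : ℂ × ℂ × ℂ) (h : P₀.1 ^ 2 ≠ 4 * P₀.2.1) :
    ∃ δ : ℝ, 0 < δ ∧ ∀ P : ℂ × ℂ × ℂ, dist P P₀ < δ → P.1 ^ 2 ≠ 4 * P.2.1 := by
  have hcont : Continuous fun P : ℂ × ℂ × ℂ => P.1 ^ 2 - 4 * P.2.1 := by fun_prop
  have hopen : IsOpen {P : ℂ × ℂ × ℂ | P.1 ^ 2 - 4 * P.2.1 ≠ 0} := isOpen_ne_fun hcont continuous_const
  obtain ⟨δ, hδ, hball⟩ := Metric.isOpen_iff.1 hopen P₀ (sub_ne_zero.2 h)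
  exact ⟨δ, hδ, fun P hP => sub_ne_zero.1 (hball (Metric.mem_ball.2 hP))⟩

variable [Fintype W] [DecidableEq W]

omit [DecidableEq W] in
/-- A positive lower bound for finitely many positive numbers. [folklore] -/
private theorem exists_pos_forall_le' (δ : W → ℝ) (hδ : ∀ w, 0 < δ w) : ∃ ε : ℝ, 0 < ε ∧ ∀ w, ε ≤ δ w := by
  by_cases hW : (Finset.univ : Finset W).Nonempty
  · exact ⟨Finset.univ.inf' hW δ, (Finset.lt_inf'_iff hW).2 fun w _ => hδ w, fun w => Finset.inf'_le _ (Finset.mem_univ w)⟩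
  · exact ⟨1, one_pos, fun w => absurd ⟨w, Finset.mem_univ w⟩ hW⟩

/-! ## §1 (F0) The dichotomy: a class value of some chart, or far from every class image -/

/-- **(F0) DICHOTOMY**: either `b` is the class of some chart point, or one radius `ε > 0` separates `b` from EVERY class image (finitely many charts, each image closed ★
`isClosed_range_bzClassMap`) — the vacuous branch of the payer (`fH := 0`). [cite: Bouaziz1994IntegralesOrbitales, §2.3 Lemme 2.3.1; §5.1 p. 588] -/
theorem exists_bzClassMap_eq_or_exists_forall_le_dist (b : W → ℂ × ℂ × ℂ) :
    (∃ (S : Finset W) (c : W → Fin 3 → ℝ), bzClassMap S c = b) ∨ ∃ ε : ℝ, 0 < ε ∧ ∀ (S : Finset W) (c : W → Fin 3 → ℝ), ε ≤ dist (bzClassMap S c) b := by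
  by_cases hex : ∃ (S : Finset W) (c : W → Fin 3 → ℝ), bzClassMap S c = b
  · exact Or.inl hex
  · right
    push Not at hex
    have hfar : ∀ S : Finset W, ∃ ε : ℝ, 0 < ε ∧ ∀ c : W → Fin 3 → ℝ, ε ≤ dist (bzClassMap S c) b := fun S => by
      have hb' : b ∈ (Set.range (bzClassMap S))ᶜ := fun ⟨c, hc⟩ => hex S c hc
      obtain ⟨ε, hε, hball⟩ := Metric.isOpen_iff.1 (isClosed_range_bzClassMap S).isOpen_compl b hb'
      exact ⟨ε, hε, fun c => not_lt.1 fun h => hball (Metric.mem_ball.2 h) ⟨c, rfl⟩⟩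
    choose ε hε hεfar using hfar
    refine ⟨Finset.univ.inf' ⟨∅, Finset.mem_univ _⟩ ε, (Finset.lt_inf'_iff _).2 fun S _ => hε S, fun S c => ?_⟩
    exact (Finset.inf'_le _ (Finset.mem_univ S)).trans (hεfar S c)

/-! ## §2 (F1) `hW0`: the chart types near `b` relative to a reference chart -/

section Frame

variable {b : W → ℂ × ℂ × ℂ} {S_b : Finset W} {c_b : W → Fin 3 → ℝ} (hb : bzClassMap S_b c_b = b)
  (Z S₀ : Finset W) (hZ : ∀ w, w ∈ Z ↔ (b w).1 ^ 2 = 4 * (b w).2.1) (hS₀ : ∀ w, w ∈ S₀ ↔ w ∈ S_b ∧ (b w).1 ^ 2 ≠ 4 * (b w).2.1)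

include hb hZ hS₀ in
/-- **(F1) = `hW0` of (W4), VERBATIM**: one radius `ε₀ > 0` such that every chart `S` with a (regular) point in the `ε₀`-tube of `b` has `S ∖ Z = S₀` — the places of `S` off the central set
are exactly the split-regular places of the reference chart (★ (W0a); the regularity hypothesis is carried for the consumer's text and not used). [cite: Bouaziz1994IntegralesOrbitales, §5.1 p. 588]
[cite: Shelstad1979, §4 p. 23] -/
theorem exists_forall_sdiff_eq_of_dist_bzClassMap_lt :
    ∃ ε₀ : ℝ, 0 < ε₀ ∧ ∀ (S : Finset W) (c : W → Fin 3 → ℝ), c ∈ RegS S → dist (bzClassMap S c) b < ε₀ → S \ Z = S₀ := by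
  obtain ⟨ε, hε, htype⟩ := exists_forall_mem_iff_of_dist_bzClassMap_lt b
  refine ⟨ε, hε, fun S c _ hd => ?_⟩
  have hbd : dist (bzClassMap S_b c_b) b < ε := by rw [hb, dist_self]; exact hε
  have key := htype S S_b c c_b hd hbd
  ext w
  rw [Finset.mem_sdiff, hZ, hS₀]
  constructor
  · rintro ⟨hwS, hwZ⟩
    exact ⟨(key w hwZ).1 hwS, hwZ⟩
  · rintro ⟨hwSb, hwZ⟩
    exact ⟨(key w hwZ).2 hwSb, hwZ⟩

omit [Fintype W] [DecidableEq W] in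
include hZ hS₀ in
/-- The reference chart itself is a level chart: `S_b = S₀ ∪ (S_b ∩ Z)`, `S₀ ∩ Z = ∅`-style bookkeeping — `S₀ ⊆ S_b` and `S₀` misses `Z`. [cite: Bouaziz1994IntegralesOrbitales, §5.1 p. 588] -/
theorem frame_subset_and_disjoint : S₀ ⊆ S_b ∧ ∀ w ∈ S₀, w ∉ Z := by
  refine ⟨fun w hw => ((hS₀ w).1 hw).1, fun w hw hwZ => ((hS₀ w).1 hw).2 ((hZ w).1 hwZ)⟩

/-! ## §3 (F2) The fibre points of the level charts `S₀ ∪ T`, `T ⊆ Z`, ON the walls -/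

include hb hZ hS₀ in
/-- **(F2) FIBRE POINT OF A LEVEL CHART, ON THE WALLS.**  For `T ⊆ Z` the chart `S₀ ∪ T` sees `b` at a point `c_T` which lies ON the wall of `S₀ ∪ T` at every central place
(`c_T w 0 = c_T w 2` at `w ∈ Z ∖ T` — compact there —, `c_T w 0 = 0` at `w ∈ T` — split there: the Cayley point), is REGULAR at every place off `Z` (distinct block eigenvalues,
`x ≠ 0`), and lies in the closure of `RegS (S₀ ∪ T)` (★ `mem_closure_regS`).  Over ★ (W0c). [cite: Shelstad1979, §4 p. 25] [cite: Bouaziz1994IntegralesOrbitales, §5.2 p. 588]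
[cite: Rogawski1990, §8.2 p. 122] -/
theorem exists_fibrePoint_wall {T : Finset W} (hT : T ⊆ Z) :
    ∃ c_T : W → Fin 3 → ℝ, bzClassMap (S₀ ∪ T) c_T = b ∧ (∀ w ∈ Z, w ∉ T → c_T w 0 = c_T w 2) ∧ (∀ w ∈ T, c_T w 0 = 0) ∧
      (∀ w, w ∉ Z → w ∉ S₀ ∪ T → Circle.exp (c_T w 0) ≠ Circle.exp (c_T w 2)) ∧ (∀ w, w ∉ Z → w ∈ S₀ ∪ T → c_T w 0 ≠ 0) ∧
      c_T ∈ closure (RegS (S₀ ∪ T)) := by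
  -- `S₀ ∪ T` agrees with `S_b` off `Z`
  have hagree : ∀ w, (b w).1 ^ 2 ≠ 4 * (b w).2.1 → (w ∈ S_b ↔ w ∈ S₀ ∪ T) := by
    intro w hw
    rw [Finset.mem_union, hS₀]
    constructor
    · exact fun h => Or.inl ⟨h, hw⟩
    · rintro (⟨h, _⟩ | h)
      · exact h
      · exact absurd ((hZ w).1 (hT h)) hw
  obtain ⟨c', hc'b, hcomp, hsplit⟩ := exists_bzClassMap_eq_of_forall_mem_iff hb (S₀ ∪ T) hagree
  refine ⟨c', hc'b, fun w hwZ hwT => hcomp w ?_ ((hZ w).1 hwZ), fun w hwT => hsplit w (Finset.mem_union_right _ hwT) ((hZ w).1 (hT hwT)), fun w hwZ hwS heq => ?_,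
    fun w hwZ hwS hx => ?_, mem_closure_regS _ _⟩
  · -- a central place outside `T` is outside `S₀ ∪ T`
    rw [Finset.mem_union, not_or]
    exact ⟨fun h => ((hS₀ w).1 h).2 ((hZ w).1 hwZ), hwT⟩
  · -- off `Z`, compact in `S₀ ∪ T`: distinct eigenvalues
    have hne : (b w).1 ^ 2 ≠ 4 * (b w).2.1 := fun h => hwZ ((hZ w).2 h)
    have h1 := sq_sub_four_mul_bzClassMap_of_not_mem hwS c'
    rw [hc'b, heq, sub_self, zero_pow two_ne_zero] at h1
    exact hne (sub_eq_zero.1 h1)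
  · -- off `Z`, split in `S₀ ∪ T`: `x ≠ 0`
    have hne : (b w).1 ^ 2 ≠ 4 * (b w).2.1 := fun h => hwZ ((hZ w).2 h)
    have h1 := sq_sub_four_mul_bzClassMap_of_mem hwS c'
    rw [hc'b, hx, neg_zero, sub_self] at h1
    simp only [zero_pow two_ne_zero, Complex.ofReal_zero, zero_mul] at h1
    exact hne (sub_eq_zero.1 h1)

end Frame

/-! ## §4 (F3) Tube regularity at the places off `Z` -/

/-- **(F3) TUBE REGULARITY OFF `Z`**: one radius `ε₁ > 0` such that every chart point (of ANY chart `S`) whose class is `ε₁`-near `b` is REGULAR at every place off the central set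
`Z` — distinct eigenvalues `e^{ic_{w,0}} ≠ e^{ic_{w,2}}` at a compact place, `x_w ≠ 0` at a split place (§0 at each `b w`, W-fold minimum, ★ `sq_sub_four_mul_bzClassMap_of_(not_)mem`).
At the places of `Z` nothing is claimed (the tube crosses the wall).  ★ `exists_forall_mem_regS_of_dist_bzClassMap_lt` is the case `Z = ∅`. [cite: Bouaziz1994IntegralesOrbitales, §5.1 p. 588]
[cite: Shelstad1979, §4 p. 22] -/
theorem exists_forall_regular_off_of_dist_bzClassMap_lt (b : W → ℂ × ℂ × ℂ) (Z : Finset W) (hZ : ∀ w, w ∈ Z ↔ (b w).1 ^ 2 = 4 * (b w).2.1) :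
    ∃ ε₁ : ℝ, 0 < ε₁ ∧ ∀ (S : Finset W) (c : W → Fin 3 → ℝ), dist (bzClassMap S c) b < ε₁ →
      ∀ w, w ∉ Z → (w ∉ S → Circle.exp (c w 0) ≠ Circle.exp (c w 2)) ∧ (w ∈ S → c w 0 ≠ 0) := by
  -- per place: §0's radius off `Z`, `1` on `Z`
  have hδ : ∀ w, ∃ δ : ℝ, 0 < δ ∧ ((b w).1 ^ 2 ≠ 4 * (b w).2.1 → ∀ P : ℂ × ℂ × ℂ, dist P (b w) < δ → P.1 ^ 2 ≠ 4 * P.2.1) := by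
    intro w
    by_cases hw : (b w).1 ^ 2 ≠ 4 * (b w).2.1
    · obtain ⟨δ, hδ, h⟩ := exists_forall_sq_ne_four_mul_of_dist_lt (b w) hw
      exact ⟨δ, hδ, fun _ => h⟩
    · exact ⟨1, one_pos, fun h => absurd h hw⟩
  choose δ hδ hreg using hδ
  obtain ⟨ε, hε, hεδ⟩ := exists_pos_forall_le' δ hδ
  refine ⟨ε, hε, fun S c hc w hwZ => ?_⟩
  have hne : (b w).1 ^ 2 ≠ 4 * (b w).2.1 := fun h => hwZ ((hZ w).2 h)
  have hcw : (bzClassMap S c w).1 ^ 2 ≠ 4 * (bzClassMap S c w).2.1 :=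
    hreg w hne _ ((dist_bzClassMap_apply_le S c b w).trans_lt (hc.trans_le (hεδ w)))
  refine ⟨fun hwS heq => hcw ?_, fun hwS hx => hcw ?_⟩
  · have h1 := sq_sub_four_mul_bzClassMap_of_not_mem hwS c
    rw [heq, sub_self, zero_pow two_ne_zero] at h1
    exact sub_eq_zero.1 h1
  · have h1 := sq_sub_four_mul_bzClassMap_of_mem hwS c
    rw [hx, neg_zero, sub_self] at h1
    simp only [zero_pow two_ne_zero, Complex.ofReal_zero, zero_mul] at h1
    exact sub_eq_zero.1 h1

/-- (F3) in the binder's tokens: on the `ε₁`-tube of a level chart `S₀ ∪ T` the compact places off `Z` are off their walls. [cite: Bouaziz1994IntegralesOrbitales, §5.1 p. 588] -/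
theorem exists_forall_circleExp_ne_off_of_dist_bzClassMap_lt (b : W → ℂ × ℂ × ℂ) (Z S₀ : Finset W) (hZ : ∀ w, w ∈ Z ↔ (b w).1 ^ 2 = 4 * (b w).2.1) :
    ∃ ε₁ : ℝ, 0 < ε₁ ∧ ∀ T, T ⊆ Z → ∀ c : W → Fin 3 → ℝ, dist (bzClassMap (S₀ ∪ T) c) b < ε₁ →
      ∀ w, w ∉ S₀ ∪ T → w ∉ Z → Circle.exp (c w 0) ≠ Circle.exp (c w 2) := by
  obtain ⟨ε, hε, h⟩ := exists_forall_regular_off_of_dist_bzClassMap_lt b Z hZ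
  exact ⟨ε, hε, fun T _ c hc w hwS hwZ => (h (S₀ ∪ T) c hc w hwZ).1 hwS⟩

/-! ## §5 (F4) `hQ`: the level normaliser does not vanish on the regular set -/

/-- **(F4) THE COMPACT PART OF `R_T` DOES NOT VANISH ON `RegS S`**: `∏_w (if w ∈ S then 1 else 1 − e^{i(c_{w,2} − c_{w,0})}) ≠ 0` for `c ∈ RegS S` (each compact factor is non-zero iff
`e^{ic_{w,0}} ≠ e^{ic_{w,2}}`, ★ `one_sub_coe_circleExp_sub_ne_zero_iff`). [cite: Shelstad1979, §4 p. 22] [cite: Bouaziz1994IntegralesOrbitales, §3.1 p. 579] -/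
theorem prod_ite_one_sub_circleExp_ne_zero (S : Finset W) {c : W → Fin 3 → ℝ} (hc : c ∈ RegS S) :
    (∏ w, if w ∈ S then (1 : ℂ) else (1 - (Circle.exp (c w 2 - c w 0) : ℂ))) ≠ 0 := by
  rw [Finset.prod_ne_zero_iff]
  intro w _
  by_cases hw : w ∈ S
  · rw [if_pos hw]; exact one_ne_zero
  · rw [if_neg hw]
    exact (one_sub_coe_circleExp_sub_ne_zero_iff (c w 0) (c w 2)).2 (hc.1 w hw)

/-- **(F4) = `hQ` of (W4)** for the level normaliser `Q T c := ∏_w (if w ∈ S₀ ∪ T then 1 else 1 − e^{i(c_{w,2} − c_{w,0})})`. [cite: Shelstad1979, §4 p. 22] -/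
theorem prod_ite_one_sub_circleExp_ne_zero_of_subset (Z S₀ : Finset W) :
    ∀ T, T ⊆ Z → ∀ c : W → Fin 3 → ℝ, c ∈ RegS (S₀ ∪ T) → (∏ w, if w ∈ S₀ ∪ T then (1 : ℂ) else (1 - (Circle.exp (c w 2 - c w 0) : ℂ))) ≠ 0 :=
  fun T _ _ hc => prod_ite_one_sub_circleExp_ne_zero (S₀ ∪ T) hc

/-! ## §6 The literal `Finset.filter` frame -/

omit [DecidableEq W] in
/-- The central set as a filter: membership. [cite: Bouaziz1994IntegralesOrbitales, §5.2 p. 588] -/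
theorem mem_filter_central_iff (b : W → ℂ × ℂ × ℂ) (w : W) :
    w ∈ Finset.univ.filter (fun w => (b w).1 ^ 2 = 4 * (b w).2.1) ↔ (b w).1 ^ 2 = 4 * (b w).2.1 := by
  simp only [Finset.mem_filter, Finset.mem_univ, true_and]

omit [Fintype W] [DecidableEq W] in
/-- The split-regular part as a filter: membership. [cite: Bouaziz1994IntegralesOrbitales, §5.1 p. 588] -/
theorem mem_filter_not_central_iff (b : W → ℂ × ℂ × ℂ) (S_b : Finset W) (w : W) :
    w ∈ S_b.filter (fun w => (b w).1 ^ 2 ≠ 4 * (b w).2.1) ↔ w ∈ S_b ∧ (b w).1 ^ 2 ≠ 4 * (b w).2.1 := by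
  simp only [Finset.mem_filter]

/-- **(F1) with the literal filters**: `hW0` of (W4) at `Z := univ.filter (central)`, `S₀ := S_b.filter (¬ central)`. [cite: Bouaziz1994IntegralesOrbitales, §5.1 p. 588] -/
theorem exists_forall_sdiff_eq_filter_of_dist_bzClassMap_lt {b : W → ℂ × ℂ × ℂ} {S_b : Finset W} {c_b : W → Fin 3 → ℝ} (hb : bzClassMap S_b c_b = b) :
    ∃ ε₀ : ℝ, 0 < ε₀ ∧ ∀ (S : Finset W) (c : W → Fin 3 → ℝ), c ∈ RegS S → dist (bzClassMap S c) b < ε₀ →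
      S \ Finset.univ.filter (fun w => (b w).1 ^ 2 = 4 * (b w).2.1) = S_b.filter (fun w => (b w).1 ^ 2 ≠ 4 * (b w).2.1) :=
  exists_forall_sdiff_eq_of_dist_bzClassMap_lt hb _ _ (mem_filter_central_iff b) (mem_filter_not_central_iff b S_b)

/-- **(F2) with the literal filters.** [cite: Shelstad1979, §4 p. 25] -/
theorem exists_fibrePoint_wall_filter {b : W → ℂ × ℂ × ℂ} {S_b : Finset W} {c_b : W → Fin 3 → ℝ} (hb : bzClassMap S_b c_b = b) {T : Finset W}
    (hT : T ⊆ Finset.univ.filter (fun w => (b w).1 ^ 2 = 4 * (b w).2.1)) :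
    ∃ c_T : W → Fin 3 → ℝ, bzClassMap (S_b.filter (fun w => (b w).1 ^ 2 ≠ 4 * (b w).2.1) ∪ T) c_T = b ∧
      (∀ w ∈ Finset.univ.filter (fun w => (b w).1 ^ 2 = 4 * (b w).2.1), w ∉ T → c_T w 0 = c_T w 2) ∧ (∀ w ∈ T, c_T w 0 = 0) ∧
      (∀ w, w ∉ Finset.univ.filter (fun w => (b w).1 ^ 2 = 4 * (b w).2.1) → w ∉ S_b.filter (fun w => (b w).1 ^ 2 ≠ 4 * (b w).2.1) ∪ T →
        Circle.exp (c_T w 0) ≠ Circle.exp (c_T w 2)) ∧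
      (∀ w, w ∉ Finset.univ.filter (fun w => (b w).1 ^ 2 = 4 * (b w).2.1) → w ∈ S_b.filter (fun w => (b w).1 ^ 2 ≠ 4 * (b w).2.1) ∪ T → c_T w 0 ≠ 0) ∧
      c_T ∈ closure (RegS (S_b.filter (fun w => (b w).1 ^ 2 ≠ 4 * (b w).2.1) ∪ T)) :=
  exists_fibrePoint_wall hb _ _ (mem_filter_central_iff b) (mem_filter_not_central_iff b S_b) hT

/-! ## §7 (ED. 2) Verbatim twins of the hypotheses `hF2`, `hF3` of ★ `bzLocalSurjWall_of_bricks` (p851580) — docking by bare name -/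

/-- **(F2) IN THE TOKENS OF ★ `bzLocalSurjWall_of_bricks`'s `hF2`** (conjunct order (i)(ii)(iii)(iv)(v), premises «`w ∉ S₀ ∪ T` ∧ central» ∕ «`w ∈ S₀ ∪ T`, `w ∉ T`» ∕ «`w ∉ S₀ ∪ T` ∧
non-central», no closure conjunct): `hF2 := exists_fibrePoint_wall_bricks`. [cite: Shelstad1979, §4 p. 25] [cite: Bouaziz1994IntegralesOrbitales, §5.2 p. 588] -/
theorem exists_fibrePoint_wall_bricks (b : W → ℂ × ℂ × ℂ) (S_b : Finset W) (c_b : W → Fin 3 → ℝ) (hb : bzClassMap S_b c_b = b)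
    (T : Finset W) (hT : T ⊆ Finset.univ.filter (fun w => (b w).1 ^ 2 = 4 * (b w).2.1)) :
    ∃ c_T : W → Fin 3 → ℝ,
      bzClassMap (S_b.filter (fun w => (b w).1 ^ 2 ≠ 4 * (b w).2.1) ∪ T) c_T = b ∧
      (∀ w, w ∉ S_b.filter (fun w => (b w).1 ^ 2 ≠ 4 * (b w).2.1) ∪ T → (b w).1 ^ 2 = 4 * (b w).2.1 → c_T w 0 = c_T w 2) ∧
      (∀ w ∈ T, c_T w 0 = 0) ∧
      (∀ w ∈ S_b.filter (fun w => (b w).1 ^ 2 ≠ 4 * (b w).2.1) ∪ T, w ∉ T → c_T w 0 ≠ 0) ∧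
      (∀ w, w ∉ S_b.filter (fun w => (b w).1 ^ 2 ≠ 4 * (b w).2.1) ∪ T → (b w).1 ^ 2 ≠ 4 * (b w).2.1 → Circle.exp (c_T w 0) ≠ Circle.exp (c_T w 2)) := by
  obtain ⟨c_T, h1, h2, h3, h4, h5, -⟩ := exists_fibrePoint_wall_filter hb hT
  refine ⟨c_T, h1, fun w hwS hcen => h2 w ((mem_filter_central_iff b w).2 hcen) (fun hwT => hwS (Finset.mem_union_right _ hwT)), h3,
    fun w hwS hwT => h5 w ?_ hwS, fun w hwS hnc => h4 w (fun hwZ => hnc ((mem_filter_central_iff b w).1 hwZ)) hwS⟩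
  -- `w ∈ S₀ ∪ T`, `w ∉ T` ⇒ `w ∈ S₀` ⇒ non-central
  intro hwZ
  rcases Finset.mem_union.1 hwS with hw0 | hw0
  · exact ((mem_filter_not_central_iff b S_b w).1 hw0).2 ((mem_filter_central_iff b w).1 hwZ)
  · exact hwT hw0

/-- **(F3) IN THE TOKENS OF ★ `bzLocalSurjWall_of_bricks`'s `hF3`** (per-chart simple form, non-centrality as the premise): `hF3 := exists_forall_circleExp_ne_of_dist_bzClassMap_lt_bricks`.
[cite: Bouaziz1994IntegralesOrbitales, §5.1 p. 588] [cite: Shelstad1979, §4 p. 22] -/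
theorem exists_forall_circleExp_ne_of_dist_bzClassMap_lt_bricks (b : W → ℂ × ℂ × ℂ) :
    ∃ ε₁ : ℝ, 0 < ε₁ ∧ ∀ (S : Finset W) (c : W → Fin 3 → ℝ), dist (bzClassMap S c) b < ε₁ →
      ∀ w, w ∉ S → (b w).1 ^ 2 ≠ 4 * (b w).2.1 → Circle.exp (c w 0) ≠ Circle.exp (c w 2) := by
  obtain ⟨ε, hε, h⟩ := exists_forall_regular_off_of_dist_bzClassMap_lt b _ (mem_filter_central_iff b)
  exact ⟨ε, hε, fun S c hc w hwS hnc => (h S c hc w (fun hwZ => hnc ((mem_filter_central_iff b w).1 hwZ))).1 hwS⟩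

end Literature.NumberTheory.Rogawski1990

end
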